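import Literature.NumberTheory.Automorphic.HidaTowerLevelsHecke
import HarnessLib

/-!
# The diagonal decomposition `Iw(b', c) = T(𝒪) · Iw(b, c)`: `U(b',c)/U(b,c)` is a torus quotient

Topic `NumberTheory/Automorphic`; namespaces `Literature.NumberTheory.Automorphic` (valued fields)
and `Literature.NumberTheory.Automorphic.BigHeckeGLn` (`K_v`); theorems only.  Proof file
supporting the named fact `Literature.NumberTheory.Automorphic.hidaControl_dominantOrdinaryPoint`
(Hida's control theorem): the local group theory behind
**`U(1, c)/U(b, c) ≅ T(1)/T(b)`** of [KhareThorne2017, §6.3] (the `Λ = 𝒪[[T(1)]]`-module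
structure of the Hida tower is through the diamond operators `⟨u⟩`, `u ∈ T(𝒪_p)`): for the valued
Iwahori subgroups `Iw(β, γ)` of `GL_n` over a valued field (`OrdinaryCompletedCohomologyGL`),

* `IwahoriCond.valued_sum_erase_le`, `valued_diag_mul_inv_diag_sub_one_le` — for `g ∈ Iw(β, γ)`,
  `g_{ii} (g⁻¹)_{ii} ≡ 1` modulo the ball of radius `γ`;
* `valued_diag_eq_one_of_lt`, `valued_diag_eq_one_of_lt'` — the diagonal entries of
  `g ∈ Iw(β, γ)` are units as soon as `γ < 1` or `β < 1`;
* `iwahoriCond_glDiagonal_iff`, **`glDiagonal_mem_valuedIwahoriSubgroup_iff`** — a diagonal matrix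
  of units lies in `Iw(β, γ)` iff its entries are `≡ 1` modulo the ball of radius `β`
  (so `diag(d) ≡ diag(d') mod Iw(β, γ)` iff `d ≡ d'`);
* **`mul_glDiagonal_inv_mem_valuedIwahoriSubgroup`** — for `g ∈ Iw(β', γ)` with unit diagonal
  `d = (g_{ii})_i` and any `β ≥ γ`: `g · diag(d)⁻¹ ∈ Iw(β, γ)` (and `diag(d)⁻¹ g ∈ Iw(β, γ)`,
  `glDiagonal_inv_mul_mem_valuedIwahoriSubgroup`): **`Iw(β', γ) = T · Iw(β, γ)`**, every coset
  of `Iw(β, γ)` in `Iw(β', γ)` has a diagonal representative;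
* for `K_v`: `exists_unitsToLocal_eq` (elements of valuation `1` are units of `𝒪_v`),
  **`exists_mul_glDiagonal_inv_mem_iwahoriLevel`** (`g ∈ Iw_v(b', c)`, `b ≤ c`, `max b' c ≥ 1` ⇒
  `g ≡ diag(u) mod Iw_v(b, c)` with `u ∈ T_n(𝒪_v)`, `u ≡ 1 mod ϖ_v^{b'}`) and
  **`glDiagonal_mul_inv_mem_iwahoriLevel_iff`** (`diag(u) ≡ diag(u') mod Iw_v(b, c)` iff
  `u ≡ u' mod ϖ_v^b`): `Iw_v(b', c)/Iw_v(b, c) ≅ T_v(b')/T_v(b)`;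
* for the Hida levels `U(b, c)` of `GL_n(𝔸_K^∞)` (`U` maximal above `p`):
  `TameLevel.diamondElement_mul_inv_mem_level_iff` (`⟨u⟩_v ≡ ⟨u'⟩_v mod U(b, c)` iff
  `u ≡ u' mod ϖ_v^b`), **`TameLevel.exists_mem_closure_diamond_mul_inv_mem_level`** (every
  `s ∈ U(b', c)` is `≡ d mod U(b, c)` for some `d` in the subgroup generated by the diamond elements
  `⟨u⟩_v`, `v ∣ p`, `u ≡ 1 mod ϖ_v^{b'}` — place by place over the finitely many `v ∣ p`),
  `TameLevel.closure_diamond_le_level`, `TameLevel.conj_mem_level_of_mem_closure_diamond` — so the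
  transversals of `U(b', c)/U(b, c)` in the transfer formula `res ∘ tr = ∑_s T_s`
  (`ArithmeticQuotientTransfer`) may be taken among products of diamond elements.

## References

* C. Khare, J. A. Thorne, *Potential automorphy and the Leopoldt conjecture*, Amer. J. Math. 139
  (2017), §6.3 (arXiv:1409.7007, held; read 2026-08-16). [KhareThorne2017]
* H. Hida, *p-adic ordinary Hecke algebras for GL(2)*, Ann. Inst. Fourier 44 (1994), §2–3 (held).
  [Hida1994AIF]
-/

noncomputable section

open scoped NumberField
open IsDedekindDomain

namespace Literature.NumberTheory.Automorphic

/-! ### Valued fields -/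

section Valued

variable {F Γ₀ : Type*} [Field F] [LinearOrderedCommGroupWithZero Γ₀] [Valued F Γ₀] {n : ℕ}

/-- `(A B)_{ii} = A_{ii} B_{ii} + ∑_{j ≠ i} A_{ij} B_{ji}`. [folklore] -/
theorem mul_apply_diag_eq (A B : Matrix (Fin n) (Fin n) F) (i : Fin n) :
    (A * B) i i = A i i * B i i + ∑ j ∈ Finset.univ.erase i, A i j * B j i := by
  rw [Matrix.mul_apply, ← Finset.add_sum_erase _ _ (Finset.mem_univ i)]

/-- For `A, B` satisfying the Iwahori conditions of radii `(β, γ)`, the off-diagonal part of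
`(A B)_{ii}` has valuation `≤ γ` (`|A_{ij}| ≤ γ` for `j < i`, `|B_{ji}| ≤ γ` for `j > i`).
[folklore] -/
theorem IwahoriCond.valued_sum_erase_le {β γ : Γ₀} {A B : Matrix (Fin n) (Fin n) F}
    (hA : IwahoriCond (Fin n) β γ A) (hB : IwahoriCond (Fin n) β γ B) (i : Fin n) :
    Valued.v (∑ j ∈ Finset.univ.erase i, A i j * B j i) ≤ γ := by
  refine Valued.v.map_sum_le fun j hj => ?_
  rw [map_mul]
  rcases lt_or_gt_of_ne (Finset.ne_of_mem_erase hj) with hji | hij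
  · simpa using mul_le_mul' ((hA.lower i j hji).trans (min_le_right _ _)) (hB.le_one j i)
  · simpa using mul_le_mul' (hA.le_one i j) ((hB.lower j i hij).trans (min_le_right _ _))

/-- For `g ∈ Iw(β, γ)`: **`g_{ii} (g⁻¹)_{ii} ≡ 1` modulo the ball of radius `γ`.** [folklore] -/
theorem valued_diag_mul_inv_diag_sub_one_le {β γ : Γ₀} {g : GL (Fin n) F}
    (hg : g ∈ valuedIwahoriSubgroup (Fin n) β γ) (i : Fin n) :
    Valued.v ((g : Matrix (Fin n) (Fin n) F) i i * ((g⁻¹ : GL (Fin n) F) : Matrix (Fin n) (Fin n) F) i i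
      - 1) ≤ γ := by
  have h1 : ((g : Matrix (Fin n) (Fin n) F) * ((g⁻¹ : GL (Fin n) F) : Matrix (Fin n) (Fin n) F)) i i = 1 := by
    rw [Units.mul_inv, Matrix.one_apply_eq]
  rw [mul_apply_diag_eq] at h1
  rw [show (g : Matrix (Fin n) (Fin n) F) i i * ((g⁻¹ : GL (Fin n) F) : Matrix (Fin n) (Fin n) F) i i - 1 =
      -(∑ j ∈ Finset.univ.erase i, (g : Matrix (Fin n) (Fin n) F) i j *
        ((g⁻¹ : GL (Fin n) F) : Matrix (Fin n) (Fin n) F) j i) by rw [← h1]; ring,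
    Valuation.map_neg]
  exact IwahoriCond.valued_sum_erase_le hg.1 hg.2 i

/-- **The diagonal entries of `g ∈ Iw(β, γ)` are units when `γ < 1`** (`g` upper triangular modulo
a proper ball and `g g⁻¹ = 1`). [folklore] -/
theorem valued_diag_eq_one_of_lt {β γ : Γ₀} (hγ : γ < 1) {g : GL (Fin n) F}
    (hg : g ∈ valuedIwahoriSubgroup (Fin n) β γ) (i : Fin n) :
    Valued.v ((g : Matrix (Fin n) (Fin n) F) i i) = 1 := by
  have hprod : Valued.v ((g : Matrix (Fin n) (Fin n) F) i i *
      ((g⁻¹ : GL (Fin n) F) : Matrix (Fin n) (Fin n) F) i i) = 1 := by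
    rw [show (g : Matrix (Fin n) (Fin n) F) i i * ((g⁻¹ : GL (Fin n) F) : Matrix (Fin n) (Fin n) F) i i =
        1 + ((g : Matrix (Fin n) (Fin n) F) i i * ((g⁻¹ : GL (Fin n) F) : Matrix (Fin n) (Fin n) F) i i
          - 1) by ring]
    exact Valued.v.map_one_add_of_lt ((valued_diag_mul_inv_diag_sub_one_le hg i).trans_lt hγ)
  rw [map_mul] at hprod
  refine le_antisymm (hg.1.le_one i i) ?_
  calc (1 : Γ₀) = _ := hprod.symm
    _ ≤ Valued.v ((g : Matrix (Fin n) (Fin n) F) i i) * 1 := mul_le_mul_right (hg.2.le_one i i) _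
    _ = _ := mul_one _

/-- The diagonal entries of `g ∈ Iw(β, γ)` are units when `β < 1` (they are `≡ 1`). [folklore] -/
theorem valued_diag_eq_one_of_lt' {β γ : Γ₀} (hβ : β < 1) {g : GL (Fin n) F}
    (hg : g ∈ valuedIwahoriSubgroup (Fin n) β γ) (i : Fin n) :
    Valued.v ((g : Matrix (Fin n) (Fin n) F) i i) = 1 := by
  rw [show (g : Matrix (Fin n) (Fin n) F) i i = 1 + ((g : Matrix (Fin n) (Fin n) F) i i - 1) by ring]
  exact Valued.v.map_one_add_of_lt ((hg.1.diag i).trans_lt hβ)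

/-- The Iwahori conditions for a diagonal matrix of units: the entries are `≡ 1` modulo the ball
of radius `β`. [folklore] -/
theorem iwahoriCond_glDiagonal_iff {β γ : Γ₀} {d : Fin n → Fˣ} (hd : ∀ j, Valued.v (d j : F) = 1) :
    IwahoriCond (Fin n) β γ (glDiagonal n F d : Matrix (Fin n) (Fin n) F) ↔
      ∀ j, Valued.v ((d j : F) - 1) ≤ β := by
  constructor
  · intro h j
    have := h.diag j
    rwa [coe_glDiagonal, Matrix.diagonal_apply_eq] at this
  · intro h
    refine ⟨fun i j => ?_, fun i j hij => ?_, fun i => ?_⟩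
    · rw [coe_glDiagonal, Matrix.diagonal_apply]
      split_ifs
      · exact (hd i).le
      · simp
    · rw [coe_glDiagonal, Matrix.diagonal_apply_ne _ (ne_of_gt hij), map_zero]
      exact zero_le
    · rw [coe_glDiagonal, Matrix.diagonal_apply_eq]
      exact h i

omit [LinearOrderedCommGroupWithZero Γ₀] [Valued F Γ₀] in
/-- `x⁻¹ - 1 = x⁻¹ (1 - x)`. [folklore] -/
private theorem units_inv_sub_one (x : Fˣ) :
    ((x⁻¹ : Fˣ) : F) - 1 = ((x⁻¹ : Fˣ) : F) * (1 - (x : F)) := by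
  rw [mul_sub, mul_one, Units.inv_mul]

/-- For a unit `x` of `𝒪`: `|x⁻¹ - 1| = |x - 1|`. [folklore] -/
theorem valued_units_inv_sub_one {x : Fˣ} (hx : Valued.v (x : F) = 1) :
    Valued.v (((x⁻¹ : Fˣ) : F) - 1) = Valued.v ((x : F) - 1) := by
  rw [units_inv_sub_one, map_mul, Units.val_inv_eq_inv_val, map_inv₀, hx, inv_one, one_mul,
    Valuation.map_sub_swap]

/-- **A diagonal matrix of units lies in `Iw(β, γ)` iff its entries are `≡ 1` modulo the ball of
radius `β`** (so `diag(d) Iw(β, γ) = diag(d') Iw(β, γ)` iff `d ≡ d'`). [folklore] -/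
theorem glDiagonal_mem_valuedIwahoriSubgroup_iff {β γ : Γ₀} {d : Fin n → Fˣ}
    (hd : ∀ j, Valued.v (d j : F) = 1) :
    glDiagonal n F d ∈ valuedIwahoriSubgroup (Fin n) β γ ↔ ∀ j, Valued.v ((d j : F) - 1) ≤ β := by
  have hd' : ∀ j, Valued.v ((d⁻¹ : Fin n → Fˣ) j : F) = 1 := fun j => by
    rw [Pi.inv_apply, Units.val_inv_eq_inv_val, map_inv₀, hd, inv_one]
  rw [mem_valuedIwahoriSubgroup_iff, ← map_inv, iwahoriCond_glDiagonal_iff hd,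
    iwahoriCond_glDiagonal_iff hd']
  exact ⟨fun h => h.1, fun h => ⟨h, fun j => by rw [Pi.inv_apply, valued_units_inv_sub_one (hd j)]; exact h j⟩⟩

/-- `diag(d) diag(d')⁻¹ ∈ Iw(β, γ)` iff `d ≡ d'` modulo the ball of radius `β` (units `d, d'`).
[folklore] -/
theorem glDiagonal_mul_inv_mem_valuedIwahoriSubgroup_iff {β γ : Γ₀} {d d' : Fin n → Fˣ}
    (hd : ∀ j, Valued.v (d j : F) = 1) (hd' : ∀ j, Valued.v (d' j : F) = 1) :
    glDiagonal n F d * (glDiagonal n F d')⁻¹ ∈ valuedIwahoriSubgroup (Fin n) β γ ↔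
      ∀ j, Valued.v ((d j : F) - d' j) ≤ β := by
  rw [← map_inv, ← map_mul, glDiagonal_mem_valuedIwahoriSubgroup_iff fun j => by
    rw [Pi.mul_apply, Pi.inv_apply, Units.val_mul, map_mul, Units.val_inv_eq_inv_val, map_inv₀, hd,
      hd', inv_one, mul_one]]
  refine forall_congr' fun j => ?_
  rw [Pi.mul_apply, Pi.inv_apply, Units.val_mul, Units.val_inv_eq_inv_val,
    show (d j : F) * ((d' j : F))⁻¹ - 1 = ((d j : F) - d' j) * ((d' j : F))⁻¹ by
      rw [sub_mul, mul_inv_cancel₀ (d' j).ne_zero],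
    map_mul, map_inv₀, hd', inv_one, mul_one]

/-- **`Iw(β', γ) = T · Iw(β, γ)`** (`γ ≤ β`): for `g ∈ Iw(β', γ)` with unit diagonal `d = (g_{ii})`,
`g · diag(d)⁻¹ ∈ Iw(β, γ)` — every coset of `Iw(β, γ)` in `Iw(β', γ)` has a diagonal (diamond)
representative. [cite: KhareThorne2017, §6.3 (U(1,c)/U(b,c) ≅ T(1)/T(b))] -/
theorem mul_glDiagonal_inv_mem_valuedIwahoriSubgroup {β β' γ : Γ₀} (hγβ : γ ≤ β) {g : GL (Fin n) F}
    (hg : g ∈ valuedIwahoriSubgroup (Fin n) β' γ) {d : Fin n → Fˣ}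
    (hdg : ∀ i, (d i : F) = (g : Matrix (Fin n) (Fin n) F) i i) (hd : ∀ i, Valued.v (d i : F) = 1) :
    g * (glDiagonal n F d)⁻¹ ∈ valuedIwahoriSubgroup (Fin n) β γ := by
  have hmin : min β' γ ≤ min β γ := by
    rw [min_eq_right hγβ]
    exact min_le_right _ _
  rw [mem_valuedIwahoriSubgroup_iff]
  refine ⟨?_, ?_⟩
  · have hent : ∀ i j, ((g * (glDiagonal n F d)⁻¹ : GL (Fin n) F) : Matrix (Fin n) (Fin n) F) i j =
        (g : Matrix (Fin n) (Fin n) F) i j * ((d j)⁻¹ : Fˣ) := by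
      intro i j
      rw [← map_inv, Units.val_mul, coe_glDiagonal, Matrix.mul_diagonal, Pi.inv_apply]
    have hval : ∀ i j, Valued.v (((g * (glDiagonal n F d)⁻¹ : GL (Fin n) F) :
        Matrix (Fin n) (Fin n) F) i j) = Valued.v ((g : Matrix (Fin n) (Fin n) F) i j) := by
      intro i j
      rw [hent, map_mul, Units.val_inv_eq_inv_val, map_inv₀, hd, inv_one, mul_one]
    refine ⟨fun i j => (hval i j).trans_le (hg.1.le_one i j),
      fun i j hij => (hval i j).trans_le ((hg.1.lower i j hij).trans hmin), fun i => ?_⟩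
    rw [hent, ← hdg i, Units.val_inv_eq_inv_val, mul_inv_cancel₀ (d i).ne_zero, sub_self, map_zero]
    exact zero_le
  · have hent : ∀ i j, (((g * (glDiagonal n F d)⁻¹)⁻¹ : GL (Fin n) F) : Matrix (Fin n) (Fin n) F) i j =
        (d i : F) * ((g⁻¹ : GL (Fin n) F) : Matrix (Fin n) (Fin n) F) i j := by
      intro i j
      rw [mul_inv_rev, inv_inv, Units.val_mul, coe_glDiagonal, Matrix.diagonal_mul]
    have hval : ∀ i j, Valued.v ((((g * (glDiagonal n F d)⁻¹)⁻¹ : GL (Fin n) F) :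
        Matrix (Fin n) (Fin n) F) i j) = Valued.v (((g⁻¹ : GL (Fin n) F) : Matrix (Fin n) (Fin n) F) i j) := by
      intro i j
      rw [hent, map_mul, hd, one_mul]
    refine ⟨fun i j => (hval i j).trans_le (hg.2.le_one i j),
      fun i j hij => (hval i j).trans_le ((hg.2.lower i j hij).trans hmin), fun i => ?_⟩
    rw [hent, hdg i]
    exact (valued_diag_mul_inv_diag_sub_one_le hg i).trans hγβ

/-- Left version: `diag(d)⁻¹ g ∈ Iw(β, γ)` (conjugate of `g diag(d)⁻¹` by the diagonal units `d`).
[folklore] -/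
theorem glDiagonal_inv_mul_mem_valuedIwahoriSubgroup {β β' γ : Γ₀} (hγβ : γ ≤ β) {g : GL (Fin n) F}
    (hg : g ∈ valuedIwahoriSubgroup (Fin n) β' γ) {d : Fin n → Fˣ}
    (hdg : ∀ i, (d i : F) = (g : Matrix (Fin n) (Fin n) F) i i) (hd : ∀ i, Valued.v (d i : F) = 1) :
    (glDiagonal n F d)⁻¹ * g ∈ valuedIwahoriSubgroup (Fin n) β γ := by
  have h := glDiagonal_conj_mem_valuedIwahoriSubgroup hd
    (mul_glDiagonal_inv_mem_valuedIwahoriSubgroup hγβ hg hdg hd)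
  rwa [mul_assoc, inv_mul_cancel_right] at h

/-- Existence form: every `g ∈ Iw(β', γ)` with `γ < 1` or `β' < 1` is `≡ diag(d)` modulo `Iw(β, γ)`
(`γ ≤ β`) for the unit diagonal `d = (g_{ii})`, `d ≡ 1` modulo the ball of radius `β'`. [folklore] -/
theorem exists_mul_glDiagonal_inv_mem_valuedIwahoriSubgroup {β β' γ : Γ₀} (hγβ : γ ≤ β)
    (h1 : γ < 1 ∨ β' < 1) {g : GL (Fin n) F} (hg : g ∈ valuedIwahoriSubgroup (Fin n) β' γ) :
    ∃ d : Fin n → Fˣ, (∀ i, (d i : F) = (g : Matrix (Fin n) (Fin n) F) i i) ∧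
      (∀ i, Valued.v (d i : F) = 1) ∧ (∀ i, Valued.v ((d i : F) - 1) ≤ β') ∧
      g * (glDiagonal n F d)⁻¹ ∈ valuedIwahoriSubgroup (Fin n) β γ := by
  have hunit : ∀ i, Valued.v ((g : Matrix (Fin n) (Fin n) F) i i) = 1 := fun i =>
    h1.elim (fun h => valued_diag_eq_one_of_lt h hg i) fun h => valued_diag_eq_one_of_lt' h hg i
  have hne : ∀ i, (g : Matrix (Fin n) (Fin n) F) i i ≠ 0 := fun i h => by
    have := hunit i
    rw [h, map_zero] at this
    exact zero_ne_one this
  refine ⟨fun i => Units.mk0 _ (hne i), fun i => rfl, fun i => hunit i, fun i => hg.1.diag i, ?_⟩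
  exact mul_glDiagonal_inv_mem_valuedIwahoriSubgroup hγβ hg (fun i => rfl) hunit

end Valued

/-! ### The local fields `K_v`: `Iw_v(b', c)/Iw_v(b, c) ≅ T_v(b')/T_v(b)` -/

namespace BigHeckeGLn

variable {n : ℕ} {K : Type} [Field K] [NumberField K]

/-- An `n`-tuple of elements of `K_v` of valuation `1` is `unitsToLocal` of a tuple of units of
`𝒪_v`. [folklore] -/
theorem exists_unitsToLocal_eq (v : HeightOneSpectrum (𝓞 K)) {d : Fin n → (v.adicCompletion K)ˣ}
    (hd : ∀ j, Valued.v ((d j : (v.adicCompletion K)ˣ) : v.adicCompletion K) = 1) :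
    ∃ u : Fin n → (v.adicCompletionIntegers K)ˣ, unitsToLocal n v u = d := by
  have hint : (Valued.v (R := v.adicCompletion K)).Integers (v.adicCompletionIntegers K) :=
    Valuation.integer.integers _
  have hmem : ∀ j, ((d j : (v.adicCompletion K)ˣ) : v.adicCompletion K) ∈ v.adicCompletionIntegers K :=
    fun j => (HeightOneSpectrum.mem_adicCompletionIntegers (R := 𝓞 K) K v).2 (hd j).le
  have hu : ∀ j, IsUnit (⟨_, hmem j⟩ : v.adicCompletionIntegers K) := fun j =>
    hint.isUnit_iff_valuation_eq_one.2 (hd j)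
  refine ⟨fun j => (hu j).unit, funext fun j => Units.ext ?_⟩
  rfl

/-- **`Iw_v(b', c) = T_n(𝒪_v) · Iw_v(b, c)`**: for `b ≤ c`, `max b' c ≥ 1` and `g ∈ Iw_v(b', c)`
there is `u ∈ T_n(𝒪_v)`, `u ≡ 1 mod ϖ_v^{b'}` (the diagonal of `g`), with `g · diag(u)⁻¹ ∈ Iw_v(b, c)`.
[cite: KhareThorne2017, §6.3 (U(1,c)/U(b,c) ≅ T(1)/T(b))] -/
theorem exists_mul_glDiagonal_inv_mem_iwahoriLevel (v : HeightOneSpectrum (𝓞 K)) {b b' c : ℕ}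
    (hbc : b ≤ c) (h1 : 1 ≤ max b' c) {g : GL (Fin n) (v.adicCompletion K)}
    (hg : g ∈ iwahoriLevel n v b' c) :
    ∃ u : Fin n → (v.adicCompletionIntegers K)ˣ,
      (∀ j, Valued.v ((((u j : (v.adicCompletionIntegers K)ˣ) : v.adicCompletionIntegers K) :
        v.adicCompletion K) - 1) ≤ WithZero.exp (-(b' : ℤ))) ∧
      g * (glDiagonal n (v.adicCompletion K) (unitsToLocal n v u))⁻¹ ∈ iwahoriLevel n v b c := by
  have hlt : ∀ m : ℕ, 1 ≤ m → (WithZero.exp (-(m : ℤ)) : WithZero (Multiplicative ℤ)) < 1 := fun m hm => by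
    rw [← WithZero.exp_zero, WithZero.exp_lt_exp]
    omega
  have h1' : (WithZero.exp (-(c : ℤ)) : WithZero (Multiplicative ℤ)) < 1 ∨
      (WithZero.exp (-(b' : ℤ)) : WithZero (Multiplicative ℤ)) < 1 := by
    rcases le_max_iff.1 h1 with h | h
    · exact Or.inr (hlt b' h)
    · exact Or.inl (hlt c h)
  obtain ⟨d, -, hd1, hdb, hmem⟩ := exists_mul_glDiagonal_inv_mem_valuedIwahoriSubgroup
    (WithZero.exp_le_exp.2 (neg_le_neg (Int.ofNat_le.2 hbc))) h1' hg
  obtain ⟨u, rfl⟩ := exists_unitsToLocal_eq v hd1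
  exact ⟨u, hdb, hmem⟩

/-- **`diag(u) ≡ diag(u') mod Iw_v(b, c)` iff `u ≡ u' mod ϖ_v^b`** (`u, u' ∈ T_n(𝒪_v)`): the cosets
of `Iw_v(b, c)` with diagonal representatives are parametrised by `T_n(𝒪_v / ϖ_v^b)`.
[cite: KhareThorne2017, §6.3] -/
theorem glDiagonal_mul_inv_mem_iwahoriLevel_iff (v : HeightOneSpectrum (𝓞 K)) (b c : ℕ)
    (u u' : Fin n → (v.adicCompletionIntegers K)ˣ) :
    glDiagonal n (v.adicCompletion K) (unitsToLocal n v u) *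
        (glDiagonal n (v.adicCompletion K) (unitsToLocal n v u'))⁻¹ ∈ iwahoriLevel n v b c ↔
      ∀ j, Valued.v ((((u j : (v.adicCompletionIntegers K)ˣ) : v.adicCompletionIntegers K) :
          v.adicCompletion K) - (((u' j : (v.adicCompletionIntegers K)ˣ) :
            v.adicCompletionIntegers K) : v.adicCompletion K)) ≤ WithZero.exp (-(b : ℤ)) :=
  glDiagonal_mul_inv_mem_valuedIwahoriSubgroup_iff (valued_unitsToLocal v u) (valued_unitsToLocal v u')

/-- The same for the diamond elements in `GL_n(𝔸_K^∞)` and the level `U(b, c)` (`U` maximal above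
`p`, `v ∣ p`): **`⟨u⟩_v ≡ ⟨u'⟩_v mod U(b, c)` iff `u ≡ u' mod ϖ_v^b`.** [cite: KhareThorne2017, §6.3] -/
theorem TameLevel.diamondElement_mul_inv_mem_level_iff {p : ℕ} [Fact p.Prime] (𝒰 : TameLevel n K p)
    (h𝒰 : 𝒰.IsMaximalAbove) {v : HeightOneSpectrum (𝓞 K)} (hv : (p : 𝓞 K) ∈ v.asIdeal) (b c : ℕ)
    (u u' : Fin n → (v.adicCompletionIntegers K)ˣ) :
    diamondElement n K v u * (diamondElement n K v u')⁻¹ ∈ 𝒰.level b c ↔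
      ∀ j, Valued.v ((((u j : (v.adicCompletionIntegers K)ˣ) : v.adicCompletionIntegers K) :
          v.adicCompletion K) - (((u' j : (v.adicCompletionIntegers K)ˣ) :
            v.adicCompletionIntegers K) : v.adicCompletion K)) ≤ WithZero.exp (-(b : ℤ)) := by
  have hG : diamondElement n K v u * (diamondElement n K v u')⁻¹ =
      ofLocal n K v (glDiagonal n (v.adicCompletion K) (unitsToLocal n v u) *
        (glDiagonal n (v.adicCompletion K) (unitsToLocal n v u'))⁻¹) := by
    rw [diamondElement_apply, diamondElement_apply, map_mul, map_inv]
  rw [hG, ← glDiagonal_mul_inv_mem_iwahoriLevel_iff v b c u u', 𝒰.mem_level_iff]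
  constructor
  · rintro ⟨-, h⟩
    have h' := h v hv
    rwa [localComponent_ofLocal] at h'
  · intro h
    have hd : ∀ j, Valued.v (((unitsToLocal n v u * (unitsToLocal n v u')⁻¹) j :
        (v.adicCompletion K)ˣ) : v.adicCompletion K) = 1 := fun j => by
      rw [Pi.mul_apply, Pi.inv_apply, Units.val_mul, map_mul, Units.val_inv_eq_inv_val, map_inv₀,
        valued_unitsToLocal, valued_unitsToLocal, inv_one, mul_one]
    refine ⟨h𝒰.ofLocal_mem v hv _ ?_, fun w hw => ?_⟩
    · rw [← map_inv, ← map_mul]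
      exact glDiagonal_mem_valuedCongruenceSubgroup_one_of_eq_one hd
    · by_cases hwv : w = v
      · subst hwv
        rw [localComponent_ofLocal]
        exact h
      · rw [localComponent_ofLocal_of_ne hwv]
        exact one_mem _

/-- **`U(b', c) = D · U(b, c)` with `D` generated by diamond elements**: for `b ≤ c`, `max b' c ≥ 1`
and `U` maximal above `p`, every `s ∈ U(b', c)` is `≡ d mod U(b, c)` for some `d` in the subgroup
generated by the diamond elements `⟨u⟩_v` (`v ∣ p`, `u ∈ T_n(𝒪_v)`, `u ≡ 1 mod ϖ_v^{b'}`) — the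
surjectivity half of `U(b', c)/U(b, c) ≅ ∏_{v ∣ p} T_v(b')/T_v(b)` (place by place, by
`exists_mul_glDiagonal_inv_mem_iwahoriLevel`). [cite: KhareThorne2017, §6.3 (U(1,c)/U(b,c) ≅ T(1)/T(b))] -/
theorem TameLevel.exists_mem_closure_diamond_mul_inv_mem_level {p : ℕ} [Fact p.Prime]
    (𝒰 : TameLevel n K p) (h𝒰 : 𝒰.IsMaximalAbove) {b b' c : ℕ} (hbc : b ≤ c) (h1 : 1 ≤ max b' c)
    {s : FiniteAdelicGL n K} (hs : s ∈ 𝒰.level b' c) :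
    ∃ d ∈ Subgroup.closure {x : FiniteAdelicGL n K | ∃ (v : HeightOneSpectrum (𝓞 K))
        (_ : (p : 𝓞 K) ∈ v.asIdeal) (u : Fin n → (v.adicCompletionIntegers K)ˣ),
        (∀ j, Valued.v ((((u j : (v.adicCompletionIntegers K)ˣ) : v.adicCompletionIntegers K) :
          v.adicCompletion K) - 1) ≤ WithZero.exp (-(b' : ℤ))) ∧ x = diamondElement n K v u},
      s * d⁻¹ ∈ 𝒰.level b c := by
  classical
  set D := Subgroup.closure {x : FiniteAdelicGL n K | ∃ (v : HeightOneSpectrum (𝓞 K))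
        (_ : (p : 𝓞 K) ∈ v.asIdeal) (u : Fin n → (v.adicCompletionIntegers K)ˣ),
        (∀ j, Valued.v ((((u j : (v.adicCompletionIntegers K)ˣ) : v.adicCompletionIntegers K) :
          v.adicCompletion K) - 1) ≤ WithZero.exp (-(b' : ℤ))) ∧ x = diamondElement n K v u} with hD
  -- place by place over a finite set `P` of places above `p`
  have key : ∀ P : Finset (HeightOneSpectrum (𝓞 K)), (∀ v ∈ P, (p : 𝓞 K) ∈ v.asIdeal) →
      ∃ d ∈ D, s * d⁻¹ ∈ 𝒰.level b' c ∧
        ∀ w ∈ P, localComponent n K w (s * d⁻¹) ∈ iwahoriLevel n w b c := by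
    intro P
    induction P using Finset.induction_on with
    | empty => exact fun _ => ⟨1, one_mem _, by simpa using hs, fun w hw => absurd hw (by simp)⟩
    | insert v P hvP ih =>
      intro hP
      obtain ⟨d, hdD, hsd, hloc⟩ := ih fun w hw => hP w (Finset.mem_insert_of_mem hw)
      have hv : (p : 𝓞 K) ∈ v.asIdeal := hP v (Finset.mem_insert_self v P)
      have htv : localComponent n K v (s * d⁻¹) ∈ iwahoriLevel n v b' c :=
        ((𝒰.mem_level_iff b' c _).1 hsd).2 v hv
      obtain ⟨u, hub, hu⟩ := exists_mul_glDiagonal_inv_mem_iwahoriLevel v hbc h1 htv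
      have heD : diamondElement n K v u ∈ D := by
        rw [hD]
        exact Subgroup.subset_closure ⟨v, hv, u, hub, rfl⟩
      refine ⟨diamondElement n K v u * d, mul_mem heD hdD, ?_, fun w hw => ?_⟩
      · rw [mul_inv_rev, ← mul_assoc]
        exact mul_mem hsd (inv_mem (𝒰.diamondElement_mem_level h𝒰 hv c hub))
      · rw [mul_inv_rev, ← mul_assoc, map_mul, map_inv, diamondElement_apply]
        rcases Finset.mem_insert.1 hw with rfl | hw'
        · rw [localComponent_ofLocal]
          exact hu
        · have hwv : w ≠ v := fun h => hvP (h ▸ hw')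
          rw [localComponent_ofLocal_of_ne hwv, inv_one, mul_one]
          exact hloc w hw'
  obtain ⟨d, hdD, hsd, hloc⟩ := key (finite_setOf_natCast_mem_asIdeal K p).toFinset
    fun v hv => by simpa using hv
  refine ⟨d, hdD, (𝒰.mem_level_iff b c _).2 ⟨𝒰.level_le b' c hsd, fun w hw => hloc w ?_⟩⟩
  simpa using hw

/-- The generating diamond elements lie in `U(b', c)`; hence so does the subgroup they generate.
[folklore] -/
theorem TameLevel.closure_diamond_le_level {p : ℕ} [Fact p.Prime] (𝒰 : TameLevel n K p)
    (h𝒰 : 𝒰.IsMaximalAbove) (b' c : ℕ) :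
    Subgroup.closure {x : FiniteAdelicGL n K | ∃ (v : HeightOneSpectrum (𝓞 K))
        (_ : (p : 𝓞 K) ∈ v.asIdeal) (u : Fin n → (v.adicCompletionIntegers K)ˣ),
        (∀ j, Valued.v ((((u j : (v.adicCompletionIntegers K)ˣ) : v.adicCompletionIntegers K) :
          v.adicCompletion K) - 1) ≤ WithZero.exp (-(b' : ℤ))) ∧ x = diamondElement n K v u} ≤
      𝒰.level b' c := by
  refine (Subgroup.closure_le _).2 ?_
  rintro _ ⟨v, hv, u, hub, rfl⟩
  exact 𝒰.diamondElement_mem_level h𝒰 hv c hub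

/-- Every element of the subgroup generated by diamond elements `⟨u⟩_v` (`v ∣ p`, any family of
`u`'s) normalises every `U(b, c)`. [folklore] -/
theorem TameLevel.conj_mem_level_of_mem_closure_diamond {p : ℕ} [Fact p.Prime] (𝒰 : TameLevel n K p)
    (h𝒰 : 𝒰.IsMaximalAbove) (b c : ℕ) {S : Set (FiniteAdelicGL n K)}
    (hS : ∀ x ∈ S, ∃ (v : HeightOneSpectrum (𝓞 K)) (_ : (p : 𝓞 K) ∈ v.asIdeal)
      (u : Fin n → (v.adicCompletionIntegers K)ˣ), x = diamondElement n K v u)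
    {d : FiniteAdelicGL n K} (hd : d ∈ Subgroup.closure S)
    {x : FiniteAdelicGL n K} (hx : x ∈ 𝒰.level b c) : d⁻¹ * x * d ∈ 𝒰.level b c := by
  -- two-sided normalisation, stable under products and inverses
  suffices h : (∀ y ∈ 𝒰.level b c, d⁻¹ * y * d ∈ 𝒰.level b c) ∧
      ∀ y ∈ 𝒰.level b c, d * y * d⁻¹ ∈ 𝒰.level b c from h.1 x hx
  induction hd using Subgroup.closure_induction with
  | mem y hy =>
    obtain ⟨v, hv, u, rfl⟩ := hS y hy
    refine ⟨fun z hz => 𝒰.diamondElement_conj_mem_level h𝒰 hv u b c hz, fun z hz => ?_⟩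
    have h := 𝒰.diamondElement_conj_mem_level h𝒰 hv u⁻¹ b c hz
    rwa [map_inv, inv_inv] at h
  | one => exact ⟨fun y hy => by simpa using hy, fun y hy => by simpa using hy⟩
  | mul y z _ _ ihy ihz =>
    refine ⟨fun w hw => ?_, fun w hw => ?_⟩
    · have h := ihz.1 _ (ihy.1 w hw)
      rwa [show z⁻¹ * (y⁻¹ * w * y) * z = (y * z)⁻¹ * w * (y * z) by group] at h
    · have h := ihy.2 _ (ihz.2 w hw)
      rwa [show y * (z * w * z⁻¹) * y⁻¹ = y * z * w * (y * z)⁻¹ by group] at h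
  | inv y _ ihy =>
    refine ⟨fun w hw => ?_, fun w hw => ?_⟩
    · simpa using ihy.2 w hw
    · simpa using ihy.1 w hw

end BigHeckeGLn

end Literature.NumberTheory.Automorphic
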